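import Literature.Computability.Cryptography.LWESwitchMachineKernel
import Literature.Computability.Cryptography.BLPRSMachineRejParams
import HarnessLib

/-!
# The h₃ machine's modulus-switch row: remaining sampler parameters as functions of `n`, and its negligible distance to the ideal row

Topic `Computability/Cryptography` (LWE), grouping namespace `BLPRS2013`; sequel of `LWESwitchMachineKernel.lean` (the law
`machRowPMF` a coin-driven machine draws for one block of switched samples, and `tvDist_machRowPMF_le`) and of
`BLPRSMachineRejParams.lean` (the rejection sampler's parameters and `eventually_rejLaw_grid_le_pow`). Here the last
parameters are fixed — pseudo-Gaussian accuracy/precision `pgM n = n`, `pgB n = 2n + rOf n + 1`, jitter bits `jitP n = n`,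
residue bits `resL q n = n + ⌊log₂ q⌋ + 1` (`resM = 2^{resL}`), the RATIONAL multipliers `kappaHat c c_D n i = A + i/D` of the
guesses — and the per-row distance is shown negligible (everything PROVED, definitions with bodies, no named fact):

* `kappaHat_eq_multiplier` — at guess `i` the machine's multiplier IS the ideal one:
  `A + i/D = q·√((r√n)² + τᵢ²)/√π` (`multiplier_base`, `multiplier_gridTau`), so the `δ₁`-term of the rounding bound vanishes;
* `gridRow` (the ideal row of guess `i`: `t ← U(ℤ_qⁿ)`, then `switchKernelPMF` with radius `gridRadius`, bound `√n`, raising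
  `gridTau … i`) and `machGridRow` (the machine's: `machRowPMF` at all the parameters above);
* the elementary estimates `cast_q_div_resM_le` (`q/M ≤ 2^{-n}`), `modulus_div_two_pow_pgB_le` (`Q/2^{b} ≤ 2^{-n}`),
  `roundBound_grid_le` (`(s+4)(2/s)(s/2^{P+1} + κ̂/2^{b+1}) ≤ 5/2ⁿ + 10κ̂/2ⁿ` for `s = q/Q ≤ 1`);
* **`eventually_tvDist_machGridRow_le_pow`** — for polynomially bounded `q, m₃` and every `k`: eventually, for every guess
  `i < G` and every block `S` of `m₃(n)` samples, `Δ(machGridRow, gridRow) ≤ 1/n^k`.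

## References

* Z. Brakerski, A. Langlois, C. Peikert, O. Regev, D. Stehlé, *Classical hardness of learning with errors*, STOC 2013;
  arXiv:1306.0281, Cor. 3.2, Lemma 2.15 and §5 ("one can sample efficiently … to within negligible statistical distance").
  [BrakerskiEtAl2013]
* C. Peikert, *Public-key cryptosystems from the worst-case shortest vector problem*, STOC 2009, full version p. 7
  (finite precision). [Peikert2009]
* O. Regev, *On lattices, learning with errors …*, J. ACM 56 (2009), Lemma 4.1 (proof: the uniform shift `t`). [RegevLWE2009]
-/

noncomputable section

open Filter MeasureTheory Literature.Algebra.EuclideanLattices Literature.Probability.Distributions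
  Literature.Computability.Complexity
open scoped Real ENNReal

namespace Literature.Computability.Cryptography

namespace BLPRS2013

open LWE LWE.MP12

/-! ### The last parameters -/

/-- **Pseudo-Gaussian accuracy** `m_pg = n` (`Δ(ℓ', ℓ_b) ≤ 8·2^{-n}`). [cite: Peikert2009, p. 7] -/
def pgM (n : ℕ) : ℕ := n

/-- **Pseudo-Gaussian precision** `b = 2n + rOf n + 1` (beats `Q/q ≤ 2^{n+2}` in the rounding constant). [cite: Peikert2009, p. 7] -/
def pgB (n : ℕ) : ℕ := 2 * n + PGParams.rOf n + 1

/-- **Jitter bits** `P = n`. [cite: Peikert2009, p. 7] -/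
def jitP (n : ℕ) : ℕ := n

/-- **Residue bits** `L = n + ⌊log₂ q⌋ + 1` (so `q/2ᴸ ≤ 2^{-n}`). [cite: RegevLWE2009, Lemma 4.1 (proof)] -/
def resL (q : ℕ → ℕ) (n : ℕ) : ℕ := n + Nat.log 2 (q n) + 1

/-- **The residue modulus** `M = 2ᴸ`. [cite: RegevLWE2009, Lemma 4.1 (proof)] -/
def resM (q : ℕ → ℕ) (n : ℕ) : ℕ := 2 ^ resL q n

/-- The residue modulus `2ᴸ` is nonzero. [folklore] -/
instance resM.instNeZero (q : ℕ → ℕ) (n : ℕ) : NeZero (resM q n) := ⟨pow_ne_zero _ two_ne_zero⟩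

/-- **The machine's multiplier of guess `i`**: `κ̂ᵢ = A + i/D ∈ ℚ`. [cite: BrakerskiEtAl2013, §5] -/
def kappaHat (c cD n i : ℕ) : ℚ := (gridA c n : ℚ) + (i : ℚ) / (gridD cD n : ℚ)

/-- `κ̂ᵢ` as a real number. [folklore] -/
theorem cast_kappaHat (c cD n i : ℕ) : ((kappaHat c cD n i : ℚ) : ℝ) = (gridA c n : ℝ) + (i : ℝ) / (gridD cD n : ℝ) := by
  unfold kappaHat; push_cast; ring

/-- `0 ≤ κ̂ᵢ`. [folklore] -/
theorem kappaHat_nonneg (c cD n i : ℕ) : (0 : ℝ) ≤ ((kappaHat c cD n i : ℚ) : ℝ) := by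
  rw [cast_kappaHat]; positivity

/-- `κ̂ᵢ ≤ A + i` (`D ≥ 1`). [folklore] -/
theorem kappaHat_le {cD n : ℕ} (hn : 0 < n) (c i : ℕ) : ((kappaHat c cD n i : ℚ) : ℝ) ≤ (gridA c n : ℝ) + i := by
  rw [cast_kappaHat]
  have hD : (1 : ℝ) ≤ gridD cD n := by exact_mod_cast le_trans (by norm_num) (gridD_ge (cD := cD) hn)
  have hi : (0 : ℝ) ≤ i := Nat.cast_nonneg i
  have : (i : ℝ) / gridD cD n ≤ i := div_le_self hi hD
  linarith

/-! ### The machine's multiplier is the ideal one -/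

section Multiplier

variable {q : ℕ → ℕ}

/-- **`κ̂ᵢ = q·σᵢ/√π`** with `σᵢ² = (r√n)² + τᵢ²`, `r = gridRadius`, `τᵢ = gridTau q (q r √n/√π) D G i`: the machine's rational
multiplier is EXACTLY the ideal Gaussian multiplier of `LWERoundingBridges.roundLaw_eq_idealRoundLaw_map` (`n, q(n) ≥ 1`).
[cite: BrakerskiEtAl2013, §5] -/
theorem kappaHat_eq_multiplier {c cD n : ℕ} (hn : 0 < n) (hq : 0 < q n) (i : Fin (gridG q cD n)) :
    ((kappaHat c cD n i : ℚ) : ℝ) =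
      (q n : ℝ) * Real.sqrt ((gridRadius q c n * Real.sqrt n) ^ 2 +
        gridTau (q n) ((q n : ℝ) * gridRadius q c n * Real.sqrt n / √π) (gridD cD n) (gridG q cD n) i ^ 2) / √π := by
  have hπ := Real.pi_pos
  have hsπ : (0 : ℝ) < √π := Real.sqrt_pos.2 hπ
  have hrB : 0 ≤ gridRadius q c n * Real.sqrt n := mul_nonneg (gridRadius_nonneg c n) (Real.sqrt_nonneg _)
  have hmul := multiplier_gridTau hq hrB (gridD cD n) (gridG q cD n) i
  have hbase : (q n : ℝ) * gridRadius q c n * Real.sqrt n / √π = gridA c n := multiplier_base hn hq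
  -- squares agree
  have hsq : ((q n : ℝ) * Real.sqrt ((gridRadius q c n * Real.sqrt n) ^ 2 +
      gridTau (q n) ((q n : ℝ) * gridRadius q c n * Real.sqrt n / √π) (gridD cD n) (gridG q cD n) i ^ 2) / √π) ^ 2 =
      ((q n : ℝ) * gridRadius q c n * Real.sqrt n / √π + (i : ℝ) / gridD cD n) ^ 2 := by
    rw [div_pow, mul_pow, Real.sq_sqrt (by positivity), Real.sq_sqrt hπ.le]
    exact hmul
  have hL : 0 ≤ (q n : ℝ) * Real.sqrt ((gridRadius q c n * Real.sqrt n) ^ 2 +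
      gridTau (q n) ((q n : ℝ) * gridRadius q c n * Real.sqrt n / √π) (gridD cD n) (gridG q cD n) i ^ 2) / √π := by positivity
  have hR : 0 ≤ (q n : ℝ) * gridRadius q c n * Real.sqrt n / √π + (i : ℝ) / gridD cD n := by
    rw [hbase]; positivity
  rw [cast_kappaHat, ← hbase]
  exact ((sq_eq_sq₀ hL hR).1 hsq).symm

end Multiplier

/-! ### The two rows -/

section Rows

variable (q : ℕ → ℕ) [∀ n, NeZero (q n)] (m₃ : ℕ → ℕ) (c cD : ℕ) (n : ℕ)

/-- **The ideal row of guess `i`**: `t ← U(ℤ_qⁿ)`, then the reduction's kernel of Cor. 3.2 (radius `gridRadius`, bound `√n`,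
raising `τᵢ`) on a block of `m₃(n)` samples. [cite: BrakerskiEtAl2013, Cor. 3.2 with Lemma 2.15; RegevLWE2009, Lemma 4.1 (proof)] -/
def gridRow (i : Fin (gridG q cD n)) (S : Fin (m₃ n) → (Fin n → ZMod (modulus n)) × ZMod (modulus n)) :
    PMF (Fin (m₃ n) → (Fin n → ZMod (q n)) × ZMod (q n)) :=
  (PMF.uniformOfFintype (Fin n → ZMod (q n))).bind fun t =>
    switchKernelPMF n (modulus n) (q n) (gridRadius q c n) (Real.sqrt n)
      (gridTau (q n) ((q n : ℝ) * gridRadius q c n * Real.sqrt n / √π) (gridD cD n) (gridG q cD n) i) t (m₃ n) S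

/-- **The machine's row of guess `i`** (all samplers at the parameters of this file and of `BLPRSMachineRejParams.lean`).
[cite: BrakerskiEtAl2013, §5] -/
def machGridRow (i : Fin (gridG q cD n)) (S : Fin (m₃ n) → (Fin n → ZMod (modulus n)) × ZMod (modulus n)) :
    PMF (Fin (m₃ n) → (Fin n → ZMod (q n)) × ZMod (q n)) :=
  machRowPMF n (modulus n) (q n) (gridTheta c n) (rejS n) (rejN n) (rejP n) (rejW c n) (rejR n) (kappaHat c cD n i)
    (pgB n) (jitP n) (PGParams.std (pgM n) (pgB n)).lawPMF (resM q n) (m₃ n) S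

end Rows

/-! ### Elementary estimates -/

section Estimates

variable {q : ℕ → ℕ}

/-- **`q/M ≤ 2^{-n}`** (`M = 2^{n + ⌊log₂ q⌋ + 1} > 2ⁿ·q`). [folklore] -/
theorem cast_q_div_resM_le (q : ℕ → ℕ) (n : ℕ) : (q n : ℝ) / (resM q n : ℝ) ≤ 1 / (2 : ℝ) ^ n := by
  have hlt : q n < 2 ^ (Nat.log 2 (q n) + 1) := Nat.lt_pow_succ_log_self (by norm_num) _
  have hlt' : (q n : ℝ) ≤ (2 : ℝ) ^ (Nat.log 2 (q n) + 1) := by exact_mod_cast hlt.le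
  have hM : (resM q n : ℝ) = (2 : ℝ) ^ n * (2 : ℝ) ^ (Nat.log 2 (q n) + 1) := by
    unfold resM resL; push_cast; rw [← pow_add]; ring_nf
  rw [hM, div_le_div_iff₀ (by positivity) (by positivity), one_mul]
  nlinarith [pow_pos (by norm_num : (0 : ℝ) < 2) n]

/-- **`Q/2ᵇ ≤ 2^{-n}`** (`Q = 2^{⌊d/2⌋+2} ≤ 2^{n+1}` for `n ≥ 1`, `b ≥ 2n + 1`). [folklore] -/
theorem modulus_div_two_pow_pgB_le {n : ℕ} (hn : 1 ≤ n) : (modulus n : ℝ) / (2 : ℝ) ^ pgB n ≤ 1 / (2 : ℝ) ^ n := by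
  have hd : dim n / 2 + 2 ≤ n + 1 := by
    have := Nat.sqrt_le_self n
    unfold dim; omega
  have hQ : (modulus n : ℝ) ≤ (2 : ℝ) ^ (n + 1) := by
    unfold modulus; push_cast
    exact pow_le_pow_right₀ (by norm_num) hd
  have hb : (2 : ℝ) ^ (n + 1) * (2 : ℝ) ^ n ≤ (2 : ℝ) ^ pgB n := by
    rw [← pow_add]
    exact pow_le_pow_right₀ (by norm_num) (by unfold pgB; omega)
  rw [div_le_div_iff₀ (by positivity) (by positivity), one_mul]
  nlinarith [pow_pos (by norm_num : (0 : ℝ) < 2) n]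

/-- **The rounding constant at our precisions**: for `0 < s ≤ 1` and `κ ≥ 0`,
`(s+4)(2/s)(s/2^{P+1} + κ/2^{b+1}) ≤ 5/2^P + 5κ/(s·2^b)`. [folklore] -/
theorem roundConst_le {s κ : ℝ} (hs0 : 0 < s) (hs1 : s ≤ 1) (hκ : 0 ≤ κ) (P b : ℕ) :
    (s + 4) * (2 / s) * (s * (1 / 2 ^ (P + 1)) + κ * (1 / 2 ^ (b + 1))) ≤ 5 / 2 ^ P + 5 * κ / (s * 2 ^ b) := by
  have h5 : s + 4 ≤ 5 := by linarith
  have e : (s + 4) * (2 / s) * (s * (1 / 2 ^ (P + 1)) + κ * (1 / 2 ^ (b + 1))) = (s + 4) / 2 ^ P + (s + 4) * κ / (s * 2 ^ b) := by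
    field_simp; ring
  rw [e]
  gcongr

end Estimates

/-! ### The per-row distance is negligible -/

section Row

variable {q : ℕ → ℕ} [∀ n, NeZero (q n)] {m₃ : ℕ → ℕ}

/-- **`Δ(machine row, ideal row) ≤ 1/n^k` eventually**, for every guess and every block. [cite: BrakerskiEtAl2013, §5 with Cor. 3.2 and Lemma 2.15] -/
theorem eventually_tvDist_machGridRow_le_pow (hq : IsPolyBounded q) (hm : IsPolyBounded m₃) (c cD k : ℕ) :
    ∀ᶠ n : ℕ in atTop, ∀ (i : Fin (gridG q cD n)) (S : Fin (m₃ n) → (Fin n → ZMod (modulus n)) × ZMod (modulus n)),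
      (machGridRow q m₃ c cD n i S).tvDist (gridRow q m₃ c cD n i S) ≤ 1 / (n : ℝ) ^ k := by
  -- `ρ = 1/n^{c₁}` with `2 m₃ n^{k+1} ≤ n^{c₁}`
  obtain ⟨c₁, hc₁⟩ := eventually_polyBounded_le_pow hm 2 (k + 1)
  obtain ⟨pq, hpq⟩ := hq
  obtain ⟨pm, hpm⟩ := hm
  -- the exponentially small terms: `(n + m₃(13 + 10(A + q + 2))) · 2 n^k ≤ 2^{⌊d/2⌋} ≤ 2ⁿ`
  have hexp := eventually_mul_eval_le_two_pow_half_dim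
    ((Polynomial.X + pm * (13 + 10 * (3 * Polynomial.X + pq + 2))) * Polynomial.X ^ k) 2
  have hqQ := eventually_mul_eval_le_two_pow_half_dim pq 1
  filter_upwards [hc₁, eventually_rejLaw_grid_le_pow c c₁, eventually_gridA_le_three_mul c, hexp, hqQ,
    eventually_ge_atTop 16] with n hc₁n hrej hA3 hexpn hqQn h16 i S
  have hn : 0 < n := by omega
  have hn1 : 1 ≤ n := hn
  have hn' : (0 : ℝ) < n := by exact_mod_cast hn
  have hq0 : 0 < q n := Nat.pos_of_ne_zero (NeZero.ne (q n))
  have hq0' : (0 : ℝ) < q n := by exact_mod_cast hq0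
  have hq1 : (1 : ℝ) ≤ q n := by exact_mod_cast hq0
  have hQ0 : (0 : ℝ) < modulus n := by exact_mod_cast Nat.pos_of_ne_zero (NeZero.ne (modulus n))
  have hθ : 0 < gridTheta c n := gridTheta_pos hn
  have h2n : (0 : ℝ) < (2 : ℝ) ^ n := by positivity
  have hd2 : (2 : ℝ) ^ (dim n / 2) ≤ (2 : ℝ) ^ n :=
    pow_le_pow_right₀ (by norm_num) (by have := Nat.sqrt_le_self n; unfold dim; omega)
  -- `q ≤ Q`
  have hqQ' : (q n : ℝ) ≤ modulus n := by
    have h1 : ((q n : ℕ) : ℝ) ≤ ((pq.eval n : ℕ) : ℝ) := by exact_mod_cast hpq n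
    have h2 : (2 : ℝ) ^ (dim n / 2) ≤ modulus n := by
      unfold modulus; push_cast; rw [pow_add]
      have : (0 : ℝ) < (2 : ℝ) ^ (dim n / 2) := by positivity
      nlinarith
    linarith [hqQn]
  have hs0 : (0 : ℝ) < (q n : ℝ) / modulus n := div_pos hq0' hQ0
  have hs1 : (q n : ℝ) / modulus n ≤ 1 := (div_le_one hQ0).2 hqQ'
  -- the generic bound
  have hrow := tvDist_machRowPMF_le (n := n) (Q := modulus n) (q' := q n) (θ := gridTheta c n) (s := rejS n) (N := rejN n)
    (Pr := rejP n) (w := rejW c n) (R := rejR n) (κh := kappaHat c cD n i) (b := pgB n) (P := jitP n)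
    (ℓ := (PGParams.std (pgM n) (pgB n)).lawPMF) (M := resM q n) (m := m₃ n) hθ (hrej) (Real.sqrt n)
    (gridTau (q n) ((q n : ℝ) * gridRadius q c n * Real.sqrt n / √π) (gridD cD n) (gridG q cD n) i) S
  -- identify the rows and kill the `δ₁`-term
  have hr : Real.sqrt (π / (gridTheta c n : ℝ)) / q n = gridRadius q c n := rfl
  rw [hr] at hrow
  change (machGridRow q m₃ c cD n i S).tvDist (gridRow q m₃ c cD n i S) ≤ _ at hrow
  rw [← kappaHat_eq_multiplier hn hq0 i, sub_self, abs_zero, mul_zero, add_zero] at hrow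
  refine hrow.trans ?_
  -- estimate the terms
  have hκ0 := kappaHat_nonneg c cD n i
  have hκle : ((kappaHat c cD n i : ℚ) : ℝ) ≤ (gridA c n : ℝ) + q n + 2 := by
    have h1 := kappaHat_le (cD := cD) hn c (i : ℕ)
    have hi : ((i : ℕ) : ℝ) ≤ gridG q cD n := by exact_mod_cast i.2.le
    have hG : (gridG q cD n : ℝ) = q n * gridD cD n + 1 := by unfold gridG; push_cast; ring
    -- crude: `i ≤ G = qD + 1`, and `i/D ≤ q + 1`
    rw [cast_kappaHat]
    have hD : (0 : ℝ) < gridD cD n := by exact_mod_cast lt_of_lt_of_le (by norm_num) (gridD_ge (cD := cD) hn)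
    have : ((i : ℕ) : ℝ) / gridD cD n ≤ q n + 2 := by
      rw [div_le_iff₀ hD]
      have hD1 : (1 : ℝ) ≤ gridD cD n := by exact_mod_cast le_trans (by norm_num) (gridD_ge (cD := cD) hn)
      nlinarith
    linarith
  rw [abs_of_nonneg hκ0]
  have hℓ : ((PGParams.std (pgM n) (pgB n)).lawPMF).tvDist (gaussBoxPMF (pgB n)) ≤ 8 / (2 : ℝ) ^ n := by
    have h := PGParams.tvDist_lawPMF_std_gaussBoxPMF_le (pgM n) (pgB n) (by unfold pgM; omega) (by unfold pgM pgB; omega)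
    have e : (8 : ℝ) * ((2 : ℝ) ^ pgM n)⁻¹ = 8 / (2 : ℝ) ^ n := by unfold pgM; rw [div_eq_mul_inv]
    exact h.trans e.le
  have hround := roundConst_le hs0 hs1 hκ0 (jitP n) (pgB n)
  have hT_round : 5 / (2 : ℝ) ^ jitP n + 5 * ((kappaHat c cD n i : ℚ) : ℝ) / ((q n : ℝ) / modulus n * 2 ^ pgB n) ≤
      5 / (2 : ℝ) ^ n + 5 * ((gridA c n : ℝ) + q n + 2) / (2 : ℝ) ^ n := by
    have h1 : 5 * ((kappaHat c cD n i : ℚ) : ℝ) / ((q n : ℝ) / modulus n * 2 ^ pgB n) ≤ 5 * ((gridA c n : ℝ) + q n + 2) / (2 : ℝ) ^ n := by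
      -- `κ̂/(s 2^b) = κ̂ Q/(q 2^b) ≤ κ̂ · 2^{-n}` (using `q ≥ 1`, `Q/2^b ≤ 2^{-n}`)
      have hQb := modulus_div_two_pow_pgB_le hn1
      rw [show 5 * ((kappaHat c cD n i : ℚ) : ℝ) / ((q n : ℝ) / modulus n * 2 ^ pgB n) =
        5 * ((kappaHat c cD n i : ℚ) : ℝ) * ((modulus n : ℝ) / 2 ^ pgB n) / q n by field_simp]
      calc 5 * ((kappaHat c cD n i : ℚ) : ℝ) * ((modulus n : ℝ) / 2 ^ pgB n) / q n
          ≤ 5 * ((kappaHat c cD n i : ℚ) : ℝ) * ((modulus n : ℝ) / 2 ^ pgB n) / 1 :=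
            div_le_div_of_nonneg_left (by positivity) one_pos hq1
        _ ≤ 5 * ((gridA c n : ℝ) + q n + 2) * (1 / (2 : ℝ) ^ n) / 1 := by gcongr
        _ = 5 * ((gridA c n : ℝ) + q n + 2) / (2 : ℝ) ^ n := by ring
    unfold jitP
    linarith
  -- the rejection term: `m₃ · n · ρ ≤ 1/(2n^k)` from `2 m₃ n^{k+1} ≤ n^{c₁}`
  have hpc₁ : (0 : ℝ) < (n : ℝ) ^ c₁ := by positivity
  have hrejT : (m₃ n : ℝ) * (n * (1 / (n : ℝ) ^ c₁)) ≤ 1 / (2 * (n : ℝ) ^ k) := by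
    rw [mul_one_div, ← mul_div_assoc, div_le_div_iff₀ hpc₁ (by positivity)]
    have : 2 * (m₃ n : ℝ) * (n : ℝ) ^ (k + 1) ≤ (n : ℝ) ^ c₁ := hc₁n
    calc (m₃ n : ℝ) * n * (2 * (n : ℝ) ^ k) = 2 * (m₃ n : ℝ) * (n : ℝ) ^ (k + 1) := by ring
      _ ≤ (n : ℝ) ^ c₁ := this
      _ = 1 * (n : ℝ) ^ c₁ := (one_mul _).symm
  -- the exponential terms: `(n + m₃(13 + 10(A+q+2)))/2ⁿ ≤ 1/(2n^k)`
  have hexpT : ((n : ℝ) + (m₃ n : ℝ) * (13 + 10 * ((gridA c n : ℝ) + q n + 2))) / (2 : ℝ) ^ n ≤ 1 / (2 * (n : ℝ) ^ k) := by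
    rw [div_le_div_iff₀ h2n (by positivity), one_mul]
    have h := hexpn
    simp only [Polynomial.eval_mul, Polynomial.eval_add, Polynomial.eval_pow, Polynomial.eval_X, Polynomial.eval_ofNat,
      Nat.cast_mul, Nat.cast_add, Nat.cast_pow, Nat.cast_ofNat] at h
    have hm' : (m₃ n : ℝ) ≤ ((pm.eval n : ℕ) : ℝ) := by exact_mod_cast hpm n
    have hq' : (q n : ℝ) ≤ ((pq.eval n : ℕ) : ℝ) := by exact_mod_cast hpq n
    calc ((n : ℝ) + (m₃ n : ℝ) * (13 + 10 * ((gridA c n : ℝ) + q n + 2))) * (2 * (n : ℝ) ^ k)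
        = 2 * (((n : ℝ) + (m₃ n : ℝ) * (13 + 10 * ((gridA c n : ℝ) + q n + 2))) * (n : ℝ) ^ k) := by ring
      _ ≤ 2 * (((n : ℝ) + ((pm.eval n : ℕ) : ℝ) * (13 + 10 * (3 * (n : ℝ) + ((pq.eval n : ℕ) : ℝ) + 2))) * (n : ℝ) ^ k) := by
          gcongr
      _ ≤ (2 : ℝ) ^ (dim n / 2) := h
      _ ≤ (2 : ℝ) ^ n := hd2
  -- assemble: total ≤ n/2ⁿ + m₃ (nρ + 8/2ⁿ + 5/2ⁿ + 5(A+q+2)/2ⁿ)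
  have hm0 : (0 : ℝ) ≤ m₃ n := Nat.cast_nonneg _
  calc (n : ℝ) * ((q n : ℝ) / (resM q n : ℝ)) + (m₃ n : ℝ) * (n * (1 / (n : ℝ) ^ c₁) +
        (((PGParams.std (pgM n) (pgB n)).lawPMF).tvDist (gaussBoxPMF (pgB n)) +
          ((q n : ℝ) / modulus n + 4) * (2 / ((q n : ℝ) / modulus n)) *
            ((q n : ℝ) / modulus n * (1 / 2 ^ (jitP n + 1)) + ((kappaHat c cD n i : ℚ) : ℝ) * (1 / 2 ^ (pgB n + 1)))))
      ≤ (n : ℝ) * (1 / (2 : ℝ) ^ n) + (m₃ n : ℝ) * (n * (1 / (n : ℝ) ^ c₁) +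
          (8 / (2 : ℝ) ^ n + (5 / (2 : ℝ) ^ n + 5 * ((gridA c n : ℝ) + q n + 2) / (2 : ℝ) ^ n))) :=
        add_le_add (mul_le_mul_of_nonneg_left (cast_q_div_resM_le q n) hn'.le)
          (mul_le_mul_of_nonneg_left (add_le_add le_rfl (add_le_add hℓ (hround.trans hT_round))) hm0)
    _ = (m₃ n : ℝ) * (n * (1 / (n : ℝ) ^ c₁)) +
          ((n : ℝ) + (m₃ n : ℝ) * (13 + 10 * (((gridA c n : ℝ) + q n + 2) / 2))) / (2 : ℝ) ^ n := by
        field_simp; ring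
    _ ≤ (m₃ n : ℝ) * (n * (1 / (n : ℝ) ^ c₁)) +
          ((n : ℝ) + (m₃ n : ℝ) * (13 + 10 * ((gridA c n : ℝ) + q n + 2))) / (2 : ℝ) ^ n := by
        gcongr
        have : (0 : ℝ) ≤ (gridA c n : ℝ) + q n + 2 := by positivity
        linarith
    _ ≤ 1 / (2 * (n : ℝ) ^ k) + 1 / (2 * (n : ℝ) ^ k) := add_le_add hrejT hexpT
    _ = 1 / (n : ℝ) ^ k := by field_simp; ring

end Row

end BLPRS2013

end Literature.Computability.Cryptography

end
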